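import Literature.MathematicalPhysics.QuantumFieldTheory.ConstructiveQFTWave0
import HarnessLib

/-!
# Lattice words and their holonomies on the torus (cell `gauge-boot`, Lean task L1 — shared word layer)

Honest framing (cell rule): the `gauge-boot` venture produces certified bounds on lattice expectations at stated
coupling, gauge group, dimension and torus size; NOT a mass gap, NOT a continuum limit, NOT a string tension; it is
not Yang–Mills-summit-bearing (barriers `FixedCouplingUltralocality`, `PerturbativeInvisibility`).

This module is the purely algebraic WORD LAYER over the tree's torus vocabulary
`Literature.MathematicalPhysics.QuantumFieldTheory.{Site, Edge, GaugeConfig, plaquetteHolonomy}`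
(`ConstructiveQFTWave0.lean`): a STEP is `±e_μ`, a WORD is a list of steps read from a base point, its HOLONOMY is the
ordered product (left to right) of the link variables met along the word, a step `−e_μ` taken at `x` contributing
`U(x − e_μ, μ)⁻¹` — exactly the product order of the tree's `plaquetteHolonomy`
(`wordHolonomy_plaquette`).  Proved glue: multiplicativity under concatenation, reversal = inverse, backtrack
cancellation, prefix/suffix factorisation (`wordHolonomy_take_drop`), and the edge read by a step (`stepEdge`) with the
one-step formula `stepHolonomy_eq` used by the Schwinger–Dyson word calculus (`WordDerivative.lean`).

Everything here is `[folklore]` (definitions asserting nothing and one-induction lemmas); no measure theory.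
Adapted from the cross-check sketch `pub-gaugeboot-loop/lean/LoopBlocks.lean` (gen 2, rc 0), which it supersedes as
the importable module of record for the cell (FANOUT-PLAN A10/A20: neutral module under `Summits/QuantumFields/GaugeBoot/`).

References: K. Wilson, Phys. Rev. D 10 (1974) 2445 (lattice holonomies); the loop-as-reduced-word convention of the
lattice bootstrap literature, e.g. Kazakov–Zheng, arXiv:2404.16925 §2; Guo–Li–Yang–Zhu, arXiv:2502.14421 §2.
-/

namespace Summit.QuantumFields.GaugeBoot

open Literature.MathematicalPhysics.QuantumFieldTheory

variable {d L : ℕ}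

/-- A unit lattice step: forward (`+e_μ`) or backward (`−e_μ`) along axis `μ`. [folklore] -/
inductive Step (d : ℕ) : Type
  | fwd (μ : Fin d)
  | bwd (μ : Fin d)
  deriving DecidableEq, Repr

namespace Step

/-- The reversed step. [folklore] -/
def inv : Step d → Step d
  | fwd μ => bwd μ
  | bwd μ => fwd μ

/-- The axis of a step. [folklore] -/
def axis : Step d → Fin d
  | fwd μ => μ
  | bwd μ => μ

/-- Orientation flag: `true` for a forward step. [folklore] -/
def isFwd : Step d → Bool
  | fwd _ => true
  | bwd _ => false

/-- Endpoint of the step taken from `x` (periodically on the torus). [folklore] -/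
def apply (x : Site d L) : Step d → Site d L
  | fwd μ => x.shift μ
  | bwd μ => x - Pi.single μ 1

/-- The positively oriented EDGE traversed by the step taken from `x`: `(x, μ)` for `+e_μ`, `(x − e_μ, μ)` for
`−e_μ`. [folklore] -/
def edge (x : Site d L) : Step d → Edge d L
  | fwd μ => (x, μ)
  | bwd μ => (x - Pi.single μ 1, μ)

/-- Unfolding lemma `inv_fwd`. [folklore] -/
@[simp] theorem inv_fwd (μ : Fin d) : (fwd μ : Step d).inv = bwd μ := rfl
/-- Unfolding lemma `inv_bwd`. [folklore] -/
@[simp] theorem inv_bwd (μ : Fin d) : (bwd μ : Step d).inv = fwd μ := rfl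
/-- Unfolding lemma `inv_inv`. [folklore] -/
@[simp] theorem inv_inv (s : Step d) : s.inv.inv = s := by cases s <;> rfl
/-- Unfolding lemma `isFwd_fwd`. [folklore] -/
@[simp] theorem isFwd_fwd (μ : Fin d) : (fwd μ : Step d).isFwd = true := rfl
/-- Unfolding lemma `isFwd_bwd`. [folklore] -/
@[simp] theorem isFwd_bwd (μ : Fin d) : (bwd μ : Step d).isFwd = false := rfl
/-- Unfolding lemma `axis_fwd`. [folklore] -/
@[simp] theorem axis_fwd (μ : Fin d) : (fwd μ : Step d).axis = μ := rfl
/-- Unfolding lemma `axis_bwd`. [folklore] -/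
@[simp] theorem axis_bwd (μ : Fin d) : (bwd μ : Step d).axis = μ := rfl
/-- Unfolding lemma `apply_fwd`. [folklore] -/
@[simp] theorem apply_fwd (x : Site d L) (μ : Fin d) : (fwd μ).apply x = x.shift μ := rfl
/-- Unfolding lemma `apply_bwd`. [folklore] -/
@[simp] theorem apply_bwd (x : Site d L) (μ : Fin d) : (bwd μ).apply x = x - Pi.single μ 1 := rfl
/-- Unfolding lemma `edge_fwd`. [folklore] -/
@[simp] theorem edge_fwd (x : Site d L) (μ : Fin d) : (fwd μ).edge x = (x, μ) := rfl
/-- Unfolding lemma `edge_bwd`. [folklore] -/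
@[simp] theorem edge_bwd (x : Site d L) (μ : Fin d) : (bwd μ).edge x = (x - Pi.single μ 1, μ) := rfl

/-- A step and its reverse cancel on sites. [folklore] -/
@[simp] theorem apply_inv_apply (x : Site d L) (s : Step d) : s.inv.apply (s.apply x) = x := by
  cases s <;> simp [Step.apply, Step.inv, Site.shift]

/-- The reversed step, taken from the endpoint, traverses the same edge. [folklore] -/
@[simp] theorem edge_inv_apply (x : Site d L) (s : Step d) : s.inv.edge (s.apply x) = s.edge x := by
  cases s <;> simp [Step.apply, Step.inv, Step.edge, Site.shift]

end Step

/-- A lattice word: a path given by its list of steps (the base point is supplied separately). [folklore] -/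
abbrev Word (d : ℕ) : Type := List (Step d)

namespace Word

/-- Endpoint of the word started at `x`. [folklore] -/
def endpoint : Site d L → Word d → Site d L
  | x, [] => x
  | x, s :: w => endpoint (s.apply x) w

/-- The reversed word (the path traversed backwards). [folklore] -/
def reverse (w : Word d) : Word d := (w.map Step.inv).reverse

/-- The plaquette word `+e_i +e_j −e_i −e_j`. [folklore] -/
def plaquette (i j : Fin d) : Word d := [.fwd i, .fwd j, .bwd i, .bwd j]

/-- The site reached after the first `k` steps of `w` from `x` (`k`-th visited site; `siteAt x w 0 = x`). [folklore] -/
def siteAt (x : Site d L) (w : Word d) (k : ℕ) : Site d L := endpoint x (w.take k)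

/-- Unfolding lemma `endpoint_nil`. [folklore] -/
@[simp] theorem endpoint_nil (x : Site d L) : endpoint x ([] : Word d) = x := rfl

/-- Unfolding lemma `endpoint_cons`. [folklore] -/
@[simp] theorem endpoint_cons (x : Site d L) (s : Step d) (w : Word d) :
    endpoint x (s :: w) = endpoint (s.apply x) w := rfl

/-- Endpoint of a concatenation. [folklore] -/
theorem endpoint_append (x : Site d L) (v w : Word d) :
    endpoint x (v ++ w) = endpoint (endpoint x v) w := by
  induction v generalizing x with
  | nil => rfl
  | cons s v ih => simp [ih]

/-- Unfolding lemma `reverse_nil`. [folklore] -/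
@[simp] theorem reverse_nil : reverse ([] : Word d) = [] := rfl

/-- Unfolding lemma `reverse_cons`. [folklore] -/
theorem reverse_cons (s : Step d) (w : Word d) : reverse (s :: w) = reverse w ++ [s.inv] := by
  simp [Word.reverse]

/-- Reversal is an anti-homomorphism for concatenation. [folklore] -/
theorem reverse_append (v w : Word d) : reverse (v ++ w) = reverse w ++ reverse v := by
  simp [Word.reverse]

/-- Unfolding lemma `length_reverse`. [folklore] -/
@[simp] theorem length_reverse (w : Word d) : (reverse w).length = w.length := by
  simp [Word.reverse]

/-- The reversed word returns to the base point. [folklore] -/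
@[simp] theorem endpoint_reverse (x : Site d L) (w : Word d) : endpoint (endpoint x w) (reverse w) = x := by
  induction w generalizing x with
  | nil => rfl
  | cons s w ih => simp [reverse_cons, endpoint_append, ih]

/-- Unfolding lemma `siteAt_zero`. [folklore] -/
@[simp] theorem siteAt_zero (x : Site d L) (w : Word d) : siteAt x w 0 = x := rfl

/-- Unfolding lemma `siteAt_succ_cons`. [folklore] -/
@[simp] theorem siteAt_succ_cons (x : Site d L) (s : Step d) (w : Word d) (k : ℕ) :
    siteAt x (s :: w) (k + 1) = siteAt (s.apply x) w k := rfl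

/-- Unfolding lemma `length_plaquette`. [folklore] -/
@[simp] theorem length_plaquette (i j : Fin d) : (plaquette i j).length = 4 := rfl

end Word

/-! ### Holonomies -/

section Holonomy

variable {G : Type*} [Group G]

/-- Holonomy of one step from `x`: `U(x, μ)` forward, `U(x − e_μ, μ)⁻¹` backward. [folklore] -/
def stepHolonomy (U : GaugeConfig d L G) (x : Site d L) : Step d → G
  | .fwd μ => U (x, μ)
  | .bwd μ => (U (x - Pi.single μ 1, μ))⁻¹

/-- Holonomy of a word from `x`: the ordered product, left to right, of the step holonomies (the product order of
the tree's `plaquetteHolonomy` and `lineHolonomy`). [folklore] -/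
def wordHolonomy (U : GaugeConfig d L G) : Site d L → Word d → G
  | _, [] => 1
  | x, s :: w => stepHolonomy U x s * wordHolonomy U (s.apply x) w

/-- Unfolding lemma `stepHolonomy_fwd`. [folklore] -/
@[simp] theorem stepHolonomy_fwd (U : GaugeConfig d L G) (x : Site d L) (μ : Fin d) :
    stepHolonomy U x (.fwd μ) = U (x, μ) := rfl

/-- Unfolding lemma `stepHolonomy_bwd`. [folklore] -/
@[simp] theorem stepHolonomy_bwd (U : GaugeConfig d L G) (x : Site d L) (μ : Fin d) :
    stepHolonomy U x (.bwd μ) = (U (x - Pi.single μ 1, μ))⁻¹ := rfl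

/-- One-step formula through the traversed edge: `U_{edge}` or `U_{edge}⁻¹` according to orientation. [folklore] -/
theorem stepHolonomy_eq (U : GaugeConfig d L G) (x : Site d L) (s : Step d) :
    stepHolonomy U x s = if s.isFwd then U (s.edge x) else (U (s.edge x))⁻¹ := by
  cases s <;> rfl

/-- Unfolding lemma `wordHolonomy_nil`. [folklore] -/
@[simp] theorem wordHolonomy_nil (U : GaugeConfig d L G) (x : Site d L) :
    wordHolonomy U x ([] : Word d) = 1 := rfl

/-- Unfolding lemma `wordHolonomy_cons`. [folklore] -/
@[simp] theorem wordHolonomy_cons (U : GaugeConfig d L G) (x : Site d L) (s : Step d) (w : Word d) :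
    wordHolonomy U x (s :: w) = stepHolonomy U x s * wordHolonomy U (s.apply x) w := rfl

/-- Holonomy is multiplicative under concatenation. [folklore] -/
theorem wordHolonomy_append (U : GaugeConfig d L G) (x : Site d L) (v w : Word d) :
    wordHolonomy U x (v ++ w) = wordHolonomy U x v * wordHolonomy U (Word.endpoint x v) w := by
  induction v generalizing x with
  | nil => simp
  | cons s v ih => simp [ih, mul_assoc]

/-- Prefix/suffix factorisation at position `k`. [folklore] -/
theorem wordHolonomy_take_drop (U : GaugeConfig d L G) (x : Site d L) (w : Word d) (k : ℕ) :
    wordHolonomy U x (w.take k) * wordHolonomy U (Word.siteAt x w k) (w.drop k) = wordHolonomy U x w := by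
  rw [Word.siteAt, ← wordHolonomy_append, List.take_append_drop]

/-- The reverse step from the endpoint carries the inverse holonomy. [folklore] -/
@[simp] theorem stepHolonomy_apply_inv (U : GaugeConfig d L G) (x : Site d L) (s : Step d) :
    stepHolonomy U (s.apply x) s.inv = (stepHolonomy U x s)⁻¹ := by
  cases s <;> simp [Step.apply, Step.inv, stepHolonomy, Site.shift]

/-- The reversed word carries the inverse holonomy. [folklore] -/
theorem wordHolonomy_reverse (U : GaugeConfig d L G) (x : Site d L) (w : Word d) :
    wordHolonomy U (Word.endpoint x w) (Word.reverse w) = (wordHolonomy U x w)⁻¹ := by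
  induction w generalizing x with
  | nil => simp
  | cons s w ih => simp [Word.reverse_cons, wordHolonomy_append, ih, mul_inv_rev]

/-- A closed word followed by its reverse has trivial holonomy. [folklore] -/
theorem wordHolonomy_append_reverse (U : GaugeConfig d L G) (x : Site d L) (w : Word d) :
    wordHolonomy U x (w ++ Word.reverse w) = 1 := by
  rw [wordHolonomy_append, wordHolonomy_reverse, mul_inv_cancel]

/-- Backtracks cancel: `v · s · s⁻¹ · w` has the holonomy of `v · w`. [folklore] -/
theorem wordHolonomy_backtrack (U : GaugeConfig d L G) (x : Site d L) (v w : Word d) (s : Step d) :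
    wordHolonomy U x (v ++ [s, s.inv] ++ w) = wordHolonomy U x (v ++ w) := by
  simp [wordHolonomy_append]

/-- The plaquette word `+e_i +e_j −e_i −e_j` has the tree's plaquette holonomy (this pins the orientation
convention of `plaquetteHolonomy` in the word calculus). [folklore] -/
theorem wordHolonomy_plaquette (U : GaugeConfig d L G) (x : Site d L) (i j : Fin d) :
    wordHolonomy U x (Word.plaquette i j) = plaquetteHolonomy U x i j := by
  have h1 : (x.shift i).shift j - Pi.single i 1 = x.shift j := by
    simp only [Site.shift]; abel
  have h2 : x.shift j - Pi.single j 1 = x := by simp [Site.shift]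
  simp [Word.plaquette, stepHolonomy, Step.apply, plaquetteHolonomy, h1, h2, mul_assoc]

/-- The plaquette word is closed. [folklore] -/
@[simp] theorem endpoint_plaquette (x : Site d L) (i j : Fin d) :
    Word.endpoint x (Word.plaquette i j) = x := by
  simp only [Word.plaquette, Word.endpoint_cons, Word.endpoint_nil, Step.apply, Site.shift]
  abel

/-- The holonomy of a word only reads the links it traverses: two configurations agreeing on every traversed
edge give the same holonomy. [folklore] -/
theorem wordHolonomy_congr {U V : GaugeConfig d L G} (x : Site d L) (w : Word d)
    (h : ∀ k (hk : k < w.length), U ((w.get ⟨k, hk⟩).edge (Word.siteAt x w k)) =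
      V ((w.get ⟨k, hk⟩).edge (Word.siteAt x w k))) :
    wordHolonomy U x w = wordHolonomy V x w := by
  induction w generalizing x with
  | nil => simp
  | cons s w ih =>
    simp only [wordHolonomy_cons]
    have h0 := h 0 (by simp)
    simp only [List.get_eq_getElem, List.getElem_cons_zero, Word.siteAt_zero] at h0
    rw [stepHolonomy_eq, stepHolonomy_eq, h0]
    congr 1
    refine ih (s.apply x) fun k hk => ?_
    have := h (k + 1) (by simpa using hk)
    simpa using this

end Holonomy

end Summit.QuantumFields.GaugeBoot
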